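import Summits.HodgeConjecture.HodgeConjecture.Theorems.H413CharacterKnob
import Summits.HodgeConjecture.HodgeCM.Model.AdelicThetaSlotZeroAutG
import HarnessLib

/-!
# FLOOR-0 P4, seat S4′(i) ∕ S4b — SOLVING THE KNOB: `η := 1`, `ν := χ₀(·,1) · κ⁻¹`

Cell hodgecm-mathlib (D-0151), FLOOR 0, crux item H413 = stmt-HodgeConjecture-24833; P4 line (ed. 2), stub S4b.  Author F0P4-p01 (g0) (seat (i));
SEAT-i MEMO v3∕v4 §knob.  `--supports stmt-HodgeConjecture-24833 --as helper`.  DEF-FREE.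
HC_CM is proved only modulo the printed citations until rung 0 closes.

The S4b reduction theorem ★ `exists_holTheta_atLine_of_inputs` (p797429) needs the model's character datum `(η, ν)` of ★ `ThetaDistAtLine.sideAt` to
satisfy the KNOB EQUATION `finCharZero (etaT₀ η ν) (g, 1) = λ g` for a prescribed `U(V)(𝔸_f)`-character `λ` (the junction's twist restricted to `U(V)`).
When `λ` is the finite part of a RATIONALLY TRIVIAL continuous adelic character `κ` of `U(diag frameD V)(𝔸)` — which is the case for the junction's twist
(the ratio of two COMPATIBLE adelic splittings, [GelbartRogawski1991, §3.1 Remark p. 457]) — the knob is solved by the plainest datum: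
**`η := 1`** (so `hη`, `hηc` are free) and **`ν := χ₀(·, 1) · κ⁻¹`**, `χ₀ = cmLineChar₀` the tree's see-saw character of slot `0`
(rationally trivial on `U(V)` by ★ `cmLineChar₀_inl_eq_one_of_rat`, continuous by ★ `continuous_cmLineChar₀_of_signs`).  Then
`finCharZero (etaT₀ 1 ν) (g, 1) = κ (g_𝔸)` (**`finCharZero_etaT₀_one_knobNu_inl`**) and on the torus `finCharZero (etaT₀ 1 ν) (1, u) = χ₀ (1, u_𝔸)`
(**`finCharZero_etaT₀_one_knobNu_inr`**, the scalar `e u` of the `(χ)`-row); **`exists_knob`** packages `ν` with `hν`, `hνc` and both equations.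

## References
* [GelbartRogawski1991] S. Gelbart, J. Rogawski, Invent. Math. 105 (1991), §3.1 Prop. 3.1.1 p. 455; Remark p. 457 L4–13.
* [Weil1964] A. Weil, Acta Math. 111 (1964), n° 41 Thm. 6 (rational triviality of the see-saw character).
* Tree: ★ `Theorems/H413CharacterKnob` (`finCharZero_etaT₀`), ★ `HodgeCM/Model/AdelicThetaDistributionBridgeTwist` (`cmLineChar₀_inl_eq_one_of_rat`),
  ★ `HodgeCM/Model/ArchLineSlotTypeCont_1` (`continuous_cmLineChar₀_of_signs`).
-/

set_option autoImplicit false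
set_option linter.dupNamespace false

noncomputable section

open MulAction NumberField NumberField.mixedEmbedding IsDedekindDomain
open scoped Matrix TensorProduct Classical SchwartzMap
open Literature.NumberTheory.Automorphic Literature.NumberTheory.Weil1964
open Literature.NumberTheory.GelbartRogawski1991 Literature.NumberTheory.GelbartRogawski1991.UnitaryDualPair
open Literature.AlgebraicGeometry.ShimuraVarieties
open HodgeCM HodgeCM.Adelic HodgeCM.PerL34 HodgeCM.Model HodgeCM.Model.ArchSideTerm HodgeCM.Model.ThetaDistFin HodgeCM.Model.ThetaAdelicSide

namespace Summit.HodgeConjecture.HodgeConjecture.Cruxes.H413.ThetaJunction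

variable {L : CMField} {ι₁ : L →+* ℂ} (V : HermSpace3 L ι₁) (c : SeesawCtx L)
  (hGR : (cmSplittingDatum (L : Type) finProdFinEquiv (frameD V) (frameD_real V) (frameD_ne V) (dW c.D) (dW_real c.D)
    (dW_ne c.D)).CompatibleSplitting)
  (hGR₀ : (cmSplittingDatum (L : Type) (e₁) (frameD V) (frameD_real V) (frameD_ne V) (lineVec (L : Type) (dW c.D 0))
    (fun _ => dW_real c.D 0) (fun _ => dW_ne c.D 0)).CompatibleSplitting)
  (hGR₁ : (cmSplittingDatum (L : Type) (e₁) (frameD V) (frameD_real V) (frameD_ne V) (lineVec (L : Type) (dW c.D 1))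
    (fun _ => dW_real c.D 1) (fun _ => dW_ne c.D 1)).CompatibleSplitting)
  (κ : CMAdelic (L : Type) (frameD V) →* ℂˣ)

/-- group identity `(a · b⁻¹)⁻¹ · a = b` (used with the two sides' `a` only definitionally equal). [folklore] -/
theorem mul_inv_inv_mul_cancel_aux {G : Type*} [Group G] (a b : G) : (a * b⁻¹)⁻¹ * a = b := by
  rw [mul_inv_rev, inv_inv, mul_assoc, inv_mul_cancel, mul_one]

/-- `eta₀ 1 = 1`: the default split of the trivial plane character is trivial. [folklore] -/
theorem eta₀_one : eta₀ V c.D (1 : CMAdelic (L : Type) (frameD V) × CMAdelic (L : Type) (dW c.D) →* ℂˣ) = 1 :=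
  MonoidHom.ext fun _ => rfl

/-- with the trivial plane character the finite see-saw scalar of slot `0` IS `χ₀ ∘ finPairD`. [cite: GelbartRogawski1991, §3.1 Remark p. 457 L4–13] -/
theorem finCharZero_eta₀_one (g : ↥V.adelicFin) (u : UfZero c.D) :
    finCharZero V c.D hGR hGR₀ hGR₁ (eta₀ V c.D (1 : CMAdelic (L : Type) (frameD V) × CMAdelic (L : Type) (dW c.D) →* ℂˣ)) (g, u) =
      cmLineChar₀ (L : Type) finProdFinEquiv e₁ (frameD V) (frameD_real V) (frameD_ne V) (dW c.D) (dW_real c.D) (dW_ne c.D) hGR hGR₀ hGR₁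
        (finPairD V c.D (g, u)) := by
  rw [finCharZero_apply, eta₀_one, MonoidHom.one_apply, one_mul]

/-- **the knob equation on `U(V)(𝔸_f)`** for `η := 1`, `ν := χ₀(·,1) · κ⁻¹`: `finCharZero (etaT₀ 1 ν) (g, 1) = κ (g_𝔸)`.
[cite: GelbartRogawski1991, §3.1 Remark p. 457 L4–13] -/
theorem finCharZero_etaT₀_one_knobNu_inl (g : ↥V.adelicFin) :
    finCharZero V c.D hGR hGR₀ hGR₁
        (etaT₀ V c.D (1 : CMAdelic (L : Type) (frameD V) × CMAdelic (L : Type) (dW c.D) →* ℂˣ)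
          ((cmLineChar₀ (L : Type) finProdFinEquiv e₁ (frameD V) (frameD_real V) (frameD_ne V) (dW c.D) (dW_real c.D) (dW_ne c.D) hGR
              hGR₀ hGR₁).comp (MonoidHom.inl _ _) * κ⁻¹)) (g, 1) =
      κ (UnitaryGroup.finAdelicToAdelic (↥(maximalRealSubfield L)) (L : Type) (IsCMField.complexConj L) 3 (Matrix.diagonal (frameD V))
          (finFrameCongr (L : Type) V.Hm (frameG V) (frameD V) (frame_congr V) g)) := by
  rw [finCharZero_etaT₀, finCharZero_eta₀_one, finPairD_apply, map_one, MonoidHom.mul_apply, MonoidHom.comp_apply,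
    MonoidHom.inv_apply]
  exact mul_inv_inv_mul_cancel_aux _ _

/-- **the torus scalar** for `η := 1` (any `ν`): `finCharZero (etaT₀ 1 ν) (1, u) = χ₀ (1, u_𝔸)` — the `e u` of the `(χ)`-row.
[cite: GelbartRogawski1991, §3.1 Remark p. 457 L4–13] -/
theorem finCharZero_etaT₀_one_inr (ν : CMAdelic (L : Type) (frameD V) →* ℂˣ) (u : UfZero c.D) :
    finCharZero V c.D hGR hGR₀ hGR₁
        (etaT₀ V c.D (1 : CMAdelic (L : Type) (frameD V) × CMAdelic (L : Type) (dW c.D) →* ℂˣ) ν) (1, u) =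
      cmLineChar₀ (L : Type) finProdFinEquiv e₁ (frameD V) (frameD_real V) (frameD_ne V) (dW c.D) (dW_real c.D) (dW_ne c.D) hGR hGR₀ hGR₁
        (1, UnitaryGroup.finAdelicToAdelic (↥(maximalRealSubfield L)) (L : Type) (IsCMField.complexConj L) 1
          (Matrix.diagonal (lineVec (L : Type) (dW c.D 0))) u) := by
  rw [finCharZero_etaT₀, finCharZero_eta₀_one, finPairD_apply]
  simp only [map_one]
  erw [map_one ν]
  rw [inv_one, one_mul]
  rfl

/-- `ν := χ₀(·,1) · κ⁻¹` is trivial on `U(V)(L⁺)` when `κ` is. [cite: Weil1964, n° 41 Thm. 6] [cite: GelbartRogawski1991, §3.1 Remark p. 457 L4–13] -/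
theorem knobNu_eq_one_of_rat (hκ : ∀ γU ∈ CMRat (L : Type) (frameD V), κ γU = 1) (γU : CMAdelic (L : Type) (frameD V))
    (hγ : γU ∈ CMRat (L : Type) (frameD V)) :
    ((cmLineChar₀ (L : Type) finProdFinEquiv e₁ (frameD V) (frameD_real V) (frameD_ne V) (dW c.D) (dW_real c.D) (dW_ne c.D) hGR hGR₀
        hGR₁).comp (MonoidHom.inl _ _) * κ⁻¹) γU = 1 := by
  rw [MonoidHom.mul_apply, MonoidHom.comp_apply, MonoidHom.inl_apply, MonoidHom.inv_apply,
    cmLineChar₀_inl_eq_one_of_rat V c hGR hGR₀ hGR₁ hγ, hκ γU hγ, inv_one, mul_one]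

/-- `ν := χ₀(·,1) · κ⁻¹` has continuous values when `κ` has and the plane of the context has a sign at `ι₁` (`h₁W`; free for the diagonal
context, ★ `ThetaDistAtLine.h₁W_cDiag`). [cite: GelbartRogawski1991, §3.1 Prop. 3.1.1 p. 455] -/
theorem continuous_knobNu (hκc : Continuous fun v => ((κ v : ℂˣ) : ℂ))
    (h₁W : (∀ j, 0 < (ι₁ (dW c.D j)).re) ∨ ∀ j, (ι₁ (dW c.D j)).re < 0) :
    Continuous fun v => ((((cmLineChar₀ (L : Type) finProdFinEquiv e₁ (frameD V) (frameD_real V) (frameD_ne V) (dW c.D) (dW_real c.D)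
      (dW_ne c.D) hGR hGR₀ hGR₁).comp (MonoidHom.inl _ _) * κ⁻¹) v : ℂˣ) : ℂ) := by
  have h2 : Continuous fun v : CMAdelic (L : Type) (frameD V) =>
      ((cmLineChar₀ (L : Type) finProdFinEquiv e₁ (frameD V) (frameD_real V) (frameD_ne V) (dW c.D) (dW_real c.D) (dW_ne c.D) hGR hGR₀
        hGR₁ (v, 1) : ℂˣ) : ℂ) :=
    (continuous_cmLineChar₀_of_signs (L : Type) finProdFinEquiv e₁ (frameD V) (frameD_real V) (frameD_ne V) (dW c.D) (dW_real c.D)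
        (dW_ne c.D) hGR hGR₀ hGR₁ ι₁ (frameD_sign_ι₁' V) h₁W (frameD_sign_of_ne V)).comp
      (continuous_id.prodMk continuous_const)
  have h3 : Continuous fun v : CMAdelic (L : Type) (frameD V) => (((κ v)⁻¹ : ℂˣ) : ℂ) := by
    simp only [Units.val_inv_eq_inv_val]
    exact hκc.inv₀ fun v => (κ v).ne_zero
  simp only [MonoidHom.mul_apply, MonoidHom.comp_apply, MonoidHom.inl_apply, MonoidHom.inv_apply, Units.val_mul]
  exact h2.mul h3

/-- **THE KNOB IS SOLVABLE** for every rationally trivial continuous adelic `κ`: there is `ν` (namely `χ₀(·,1) · κ⁻¹`), trivial on `U(V)(L⁺)` and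
continuous, with `finCharZero (etaT₀ 1 ν) (g, 1) = κ (g_𝔸)` and `finCharZero (etaT₀ 1 ν) (1, u) = χ₀ (1, u_𝔸)`; with `η := 1` these are exactly the
inputs `hν`, `hνc`, `hknob` (and the scalar of `hχ`) of ★ `exists_holTheta_atLine_of_inputs`.
[cite: GelbartRogawski1991, §3.1 Remark p. 457 L4–13] [cite: Weil1964, n° 41 Thm. 6] -/
theorem exists_knob (hκ : ∀ γU ∈ CMRat (L : Type) (frameD V), κ γU = 1) (hκc : Continuous fun v => ((κ v : ℂˣ) : ℂ))
    (h₁W : (∀ j, 0 < (ι₁ (dW c.D j)).re) ∨ ∀ j, (ι₁ (dW c.D j)).re < 0) :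
    ∃ ν : CMAdelic (L : Type) (frameD V) →* ℂˣ,
      (∀ γU ∈ CMRat (L : Type) (frameD V), ν γU = 1) ∧ (Continuous fun v => ((ν v : ℂˣ) : ℂ)) ∧
        (∀ g : ↥V.adelicFin,
          finCharZero V c.D hGR hGR₀ hGR₁
              (etaT₀ V c.D (1 : CMAdelic (L : Type) (frameD V) × CMAdelic (L : Type) (dW c.D) →* ℂˣ) ν) (g, 1) =
            κ (UnitaryGroup.finAdelicToAdelic (↥(maximalRealSubfield L)) (L : Type) (IsCMField.complexConj L) 3
              (Matrix.diagonal (frameD V)) (finFrameCongr (L : Type) V.Hm (frameG V) (frameD V) (frame_congr V) g))) ∧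
        ∀ u : UfZero c.D,
          finCharZero V c.D hGR hGR₀ hGR₁
              (etaT₀ V c.D (1 : CMAdelic (L : Type) (frameD V) × CMAdelic (L : Type) (dW c.D) →* ℂˣ) ν) (1, u) =
            cmLineChar₀ (L : Type) finProdFinEquiv e₁ (frameD V) (frameD_real V) (frameD_ne V) (dW c.D) (dW_real c.D) (dW_ne c.D) hGR
              hGR₀ hGR₁
              (1, UnitaryGroup.finAdelicToAdelic (↥(maximalRealSubfield L)) (L : Type) (IsCMField.complexConj L) 1
                (Matrix.diagonal (lineVec (L : Type) (dW c.D 0))) u) :=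
  ⟨_, knobNu_eq_one_of_rat V c hGR hGR₀ hGR₁ κ hκ, continuous_knobNu V c hGR hGR₀ hGR₁ κ hκc h₁W,
    finCharZero_etaT₀_one_knobNu_inl V c hGR hGR₀ hGR₁ κ, finCharZero_etaT₀_one_inr V c hGR hGR₀ hGR₁ _⟩

/-- the trivial plane character satisfies `hη` of ★ `ThetaDistAtLine.sideAt`. [folklore] -/
theorem one_apply_rat_eq_one :
    ∀ γU ∈ CMRat (L : Type) (frameD V), ∀ γ ∈ CMRat (L : Type) (dW c.D),
      (1 : CMAdelic (L : Type) (frameD V) × CMAdelic (L : Type) (dW c.D) →* ℂˣ) (γU, γ) = 1 :=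
  fun _ _ _ _ => rfl

/-- … and `hηc`. [folklore] -/
theorem continuous_one_val :
    Continuous fun p : CMAdelic (L : Type) (frameD V) × CMAdelic (L : Type) (dW c.D) =>
      (((1 : CMAdelic (L : Type) (frameD V) × CMAdelic (L : Type) (dW c.D) →* ℂˣ) p : ℂˣ) : ℂ) :=
  continuous_const

end Summit.HodgeConjecture.HodgeConjecture.Cruxes.H413.ThetaJunction

end
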